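import Summits.QuantumFields.YangMills.Theorems.BalabanUVNodesN11PartCompatOfTwoSidedRunning

/-!
# DAG node N11 — THE RUN GUARD `PartCompat₁₃` IS A FLOOR ON THE RENORMALISED COUPLING `g_K`: on the record's own generated flow `gOfRecord₁₃ θ p = genSeq β₁₃ p.g₀`, the window
# `]0, γ]` and a β-ceiling READ ALONG THE RUN give the upper half of (0.31) by telescoping (0.20); so ONE floor `log(1∕g_K² + B) ≤ L^{m−a}` yields `PartCompat₁₃ θ p n` for every
# `n ≤ K`, and conversely `PartCompat₁₃ θ p K` forces `log g_K⁻² ≤ L^{m−a}`; and — LOCATED, count-neutral — the ∀-window guard binder `∀ P, window γ → PartCompat₁₃ θ P P.K` of the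
# chain road's printed faces is UNSATISFIABLE at every `γ > 0` (tiny bare couplings stay in the window and leave the last cube bigger than the torus)

HEADER — WORK-UNIT METADATA.  Cell `pub-ymgap`, YM-PLAN Track A (HUMAN RULING D-0062 ∕ D-0149 width seats), seat `pub-ymgap-dag-n11-w4` (g4; WIDTH SEAT 4 of 4 on NODE n11
[B14]), route `BalabanUVNodes`, item K1⁷ `StabilityBAtRecordR13SepCoPH` = stmt-QuantumFields-20542 (helper lane, `--kind proof --supports 20542 --as helper`, count-neutral).
[I] = [Balaban1987RG1], [III] = [Balaban1988Convergent].  Over this seat's p608879 `…N11PartCompatOfCouplings` (★★★ `partCompat₁₃_iff_log_pow_le`: at `θ.τ9.M = F.L^a` the guard IS the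
per-level scalar `(log g_i⁻²)^r ≤ L^{m+K−i−a}`; `log_pow_le_of_partCompat₁₃`) and p611474 `…N11PartCompatOfTwoSidedRunning` (★★ `partCompat₁₃_of_upperRunning`: the upper half of (0.31) as a
HYPOTHESIS + one top-level scalar ⇒ the guard), the tree's (0.20) machinery `FlowStepRuns.genSeq` ∕ `FlowStep.RGEqH` ∕ `FlowStep.inv_sq_telescopeH` ∕ `Node00.inv_sq_genSeq_succ`, and
K0a's `PartCompat₁₃` (`Node00/Record13` :1238, whose docstring already says: «a RANGE RESTRICTION ON RUNS … true along print's runs (the renormalisation condition ties `g₀` to `K`), false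
as a θ-level ∀-sentence»).

WHY THIS FILE.  g3 of this seat LOCATED the run-guard placement: dag-n11-w1 g2's chain-road producers of N11's printed output (p607924 ∕ p609410 ∕ p611894,
`thm1Printed_datumOfRecord₁₃(Sep)CoPH_…_of_gaussCert_…`) display the binder `hPC : ∀ P, Step.InInterval γ P.K (gOfRecord₁₃ θ P) → PartCompat₁₃ θ P P.K` at the SAME `γ` that witnesses the
printed window of `B16.Thm1Printed`, and dag-n11-d g14's K1 road (p609050 `…K1CeilingFreeOfSupplyChain`, `hN : ∀ P, window w.γ → SupplyChainAt θ P`) asks the chain on every run of the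
world's one-sided window; p611474 typed the guard's producer from the upper half of (0.31) taken as a hypothesis.  THIS FILE removes that hypothesis and settles both directions on the
record's OWN couplings — the run `p` of the record IS the forward-generated history `gOfRecord₁₃ θ p = genSeq (betaOfRecord₁₃ θ) p.g₀` of (0.20), so:
(A) POSITIVE.  If the run lies in a window `]0, γ]` up to `K` and the record's β-functions READ ALONG THE RUN are bounded above, `β_j(g_0,…,g_j) ≤ B` (`j < K`; this is K2⁷'s run
    currency `RunConstRemainder β b r γ₀` with `b_k ≤ B − r`, §4, or print's p. 264 «uniformly bounded»), then (0.20) holds along the run (positive branch of `solveCoupling`) and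
    telescopes to the UPPER HALF OF (0.31) with the LAST coupling as reference, `1∕g_i² ≤ 1∕g_K² + B·(K − i)` (§1) — hence, by p611474, ONE FLOOR ON THE LAST COUPLING,
    `log(1∕g_K² + B) ≤ L^{m−a}`, gives `PartCompat₁₃ θ p n` for every `n ≤ K` (§2 ★★); conversely `PartCompat₁₃ θ p K` (`K ≥ 1`, `r = 1`) forces `a ≤ m` and `log g_K⁻² ≤ L^{m−a}`
    (p608879).  So on (0.20)-runs with bounded β THE GUARD IS A FLOOR ON THE RENORMALISED COUPLING `g_K` — print's renormalisation condition ([I] Thm 2: `g_K = g` fixed), i.e. exactly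
    the clause K0a's docstring names («ties `g₀` to `K`»), now as a two-sided theorem with the slack `B` inside the logarithm.
(B) LOCATED (A6-type, count-neutral; nothing registered is denied).  Under the same β-ceiling letter at level `γ₀`, for EVERY `γ ∈ ]0, γ₀]`, EVERY length `K ≥ 1` and every `m`, the bare
    coupling `g₀ := (1∕γ² + B·K + e^{T+1})^{−1∕2}` (`T := L^{m+K−K−a}`) generates a run that STAYS in `]0, γ]` up to `K` (`1∕g_k² ≥ 1∕g₀² − k·B ≥ 1∕γ²`, §1 ★) and has
    `log g_K⁻² ≥ T + 1`, so it is NOT partition-compatible at `K` (§3 ★★★); hence the displayed binder family `∀ P, Step.InInterval γ P.K (gOfRecord₁₃ θ P) → PartCompat₁₃ θ P P.K` is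
    FALSE at EVERY `γ > 0` (a window contains `]0, min γ γ₀]`; §3 ★★★ `not_forall_window_partCompat₁₃_of_betaLe`), at every `θ` with `M = L^a` and `1 ≤ r` — in particular at K1's witness family θ₁₅ᶜᶜᴹᵂ(j; γ) (§5) — as
    soon as the record's β is bounded above along in-window (0.20)-runs (K2⁷'s letter).  CONSEQUENCE FOR THE PLAN (worded, not decided here): a face that asks the guard for ALL runs of a
    one-sided window is vacuous under K2⁷'s run letter; the guard must ride PER RUN as an antecedent next to the window (def-T's record row `bg`; n11-d's faces), or the run letter must
    carry the floor of (A) on `g_K` (print's `g_K = g`), under which §2 discharges it.  `B16.Thm1Printed`'s own window is one-sided and printed; which of the two the K1 assembly adopts is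
    the plan's ∕ def-T's ∕ the K1 lead's call.

WHAT THIS FILE PROVES (0 `sorry`, 0 `def`; elementary ℝ∕ℕ bookkeeping on (0.20); nothing of Bałaban asserted — every β-letter is a HYPOTHESIS).
§1 generic `genSeq`: `inv_sq_le_top_add_of_betaLe` (telescoped (0.20) + ceiling ⇒ upper running w.r.t. `g_K`) · ★ `window_genSeq_of_betaLe` (tiny `g₀` ⇒ the generated run stays in
   `]0, γ]` with `1∕g_k² ≥ 1∕g₀² − k·B`) · `betaLe_along_of_window` (the run-wise letter ⇒ the along-this-run letter) · `inv_sq_genSeq_le_top_add_of_betaLe`.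
§2 generic θ (`θ.τ9.M = F.L^a`, `θ.ν.r = 1`): ★★ `partCompat₁₃_of_window_of_betaLe_of_floor` · ★★ `partCompat₁₃_of_window_of_betaLeAlongRuns_of_floor` · ★ `floor_of_partCompat₁₃_top` ·
   β-FREE: ★★ `not_partCompat₁₃_top_of_window_lt_threshold` (window `γ < e^{−L^{m−a}∕2}` ⇒ no compatible run of positive length) · ★★★
   `not_forall_window_partCompat₁₃_of_exists_run_of_lt_threshold` (the crux consequent's own window clause refutes the binder below the threshold).
§3 LOCATED: ★★★ `exists_window_not_partCompat₁₃_of_betaLe` · ★★★ `not_forall_window_partCompat₁₃_of_betaLe`.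
§4 K2⁷'s currency (the SHAPE of `RunConstRemainder β b r γ₀`, unfolded; no K2 import): `betaLe_of_runConstRemainder` · ★★ `partCompat₁₃_of_window_of_runConstRemainder_of_floor` ·
   ★★★ `not_forall_window_partCompat₁₃_of_runConstRemainder`.
§5 at θ₁₅ᶜᶜᴹᵂ(j; γ) (`a = j`, `r = 1`): ★★ `partCompat₁₃_theta13OfThm1CCMW_of_window_of_betaLe_of_floor` · ★★★ `not_forall_window_partCompat₁₃_theta13OfThm1CCMW_of_betaLe`.

HONEST FRAMING.  Helper lane of K1⁷; count-neutral kernel bookkeeping; the β-ceilings ∕ K2⁷'s run letter are HYPOTHESES, inhabited at no θ here; nothing of [I]∕[III] asserted; NOT a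
discharge, NOT a refutation of any registered statement (§3 denies a displayed BINDER FAMILY of helper faces, not an item).  N11 NOT discharged; K1⁷ NOT closed; counts unmoved (typed
28∕28 · discharged 5∕27).  R4 closes only the conditional finite-𝕋⁴ rung `BalabanLadder.UV` of one programme at fixed `ε = L^{−K}` — NOT ℝ⁴, NOT OS, NOT a mass gap, NOT Clay.  No
`sorry`, `axiom`, `def`, `instance`, `notation`.  Sources (SHAPE ∕ bookkeeping only): [I] (0.18)–(0.20) pp.255–256, Thm 2 + (0.31) p.259, §1 p.264 («uniformly bounded»), (0.1) p.251;
[III] (2.1) p.254, (2.5) p.255, p.257 («we assume that all partitions are compatible»).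
-/

noncomputable section

namespace Summit.QuantumFields.YangMills.Theorems.BalabanUVNodesN11RunGuardIsCouplingFloor

open Literature.MathematicalPhysics.QuantumFieldTheory.Balaban1983to89 T4Continuum Node00
open FlowStep (HBeta RGEqH prefixOf inv_sq_telescopeH)
open FlowStepRuns (genSeq genSeq_zero genSeq_succ solveCoupling solveCoupling_pos inv_sq_solveCoupling)
open BalabanUVNodesN11PartCompatOfCouplings (log_pow_le_of_partCompat₁₃)
open BalabanUVNodesN11PartCompatOfTwoSidedRunning (partCompat₁₃_of_upperRunning)

/-! ## §1  Along a generated history `genSeq β g₀` of (0.20): the upper running from a β-ceiling, and tiny bare couplings stay in the window -/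

section GenSeq

variable {β : HBeta}

/-- An in-window generated history solves (0.20) up to its horizon (each step is the positive branch of `solveCoupling`; `Node00.inv_sq_genSeq_succ`).  Local bookkeeping copy of
the five-line fact (cf. K0's `rgEqH_genSeq_of_inInterval`, not imported here to keep this file's import closure inside N11). [cite: Balaban1987RG1, (0.18)–(0.20) pp.255–256] -/
private theorem rgEqH_genSeq_of_window {γ g0 : ℝ} {n : ℕ} (hW : Step.InInterval γ n (genSeq β g0)) : RGEqH n β (genSeq β g0) := by
  intro k hk
  have h := inv_sq_genSeq_succ β g0 (hW (k + 1) (Nat.succ_le_of_lt hk)).1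
  rw [one_div, one_div, h]
  ring

/-- **TELESCOPED (0.20) WITH A CEILING ⇒ THE UPPER RUNNING W.R.T. THE LAST COUPLING**: `RGEqH K β g` and `β_j(g_0,…,g_j) ≤ B` for `j < K` give `1∕g_i² ≤ 1∕g_K² + B·(K − i)` for
every `i ≤ K` (the upper half of [I] (0.31) in discrete form, reference coupling `g_K`; cf. `FlowStep.discrete031_of_trajBounds`, whose two-sided form also wants a floor on β).
[cite: Balaban1987RG1, (0.20) p.256, (0.31) p.259] -/
theorem inv_sq_le_top_add_of_betaLe {g : ℕ → ℝ} {K : ℕ} {B : ℝ} (h : RGEqH K β g) (hB : ∀ j, j < K → β j (prefixOf g j) ≤ B)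
    {i : ℕ} (hi : i ≤ K) : 1 / g i ^ 2 ≤ 1 / g K ^ 2 + B * ((K - i : ℕ) : ℝ) := by
  have ht := inv_sq_telescopeH h hi le_rfl
  have hsum : ∑ j ∈ Finset.Ico i K, β j (prefixOf g j) ≤ B * ((K - i : ℕ) : ℝ) := by
    have hs := Finset.sum_le_card_nsmul (Finset.Ico i K) (fun j => β j (prefixOf g j)) B
      (fun j hj => hB j (Finset.mem_Ico.mp hj).2)
    rw [nsmul_eq_mul, Nat.card_Ico] at hs
    linarith
  rw [ht]
  linarith

/-- From the lower bound `1∕g₀² − B·i ≤ 1∕x²` (`i ≤ K`, `0 ≤ B`, `1∕γ² + B·K ≤ 1∕g₀²`): `x ≤ γ`. [cite: Balaban1987RG1, (0.20) p.256 (elementary)] -/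
private theorem le_of_inv_sq_lower {γ B g0 x : ℝ} {i K : ℕ} (hγ : 0 < γ) (hB0 : 0 ≤ B) (hsmall : 1 / γ ^ 2 + B * K ≤ 1 / g0 ^ 2)
    (hi : i ≤ K) (hx : 0 < x) (hle : 1 / g0 ^ 2 - B * i ≤ 1 / x ^ 2) : x ≤ γ := by
  have hiK : (i : ℝ) ≤ K := by exact_mod_cast hi
  have hBi : B * (i : ℝ) ≤ B * K := mul_le_mul_of_nonneg_left hiK hB0
  have h1 : 1 / γ ^ 2 ≤ 1 / x ^ 2 := by linarith
  have h2 : x ^ 2 ≤ γ ^ 2 := (one_div_le_one_div (by positivity) (by positivity)).1 h1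
  exact (pow_le_pow_iff_left₀ hx.le hγ.le two_ne_zero).1 h2

/-- **★ TINY BARE COUPLINGS STAY IN THE WINDOW** (forward bookkeeping on (0.20)): if `0 < γ`, `0 ≤ B`, `0 < g₀`, `1∕γ² + B·K ≤ 1∕g₀²`, and the β-functions read along the generated
history are `≤ B` whenever the history has stayed in `]0, γ]` so far (`k < K`), then `genSeq β g₀` stays in `]0, γ]` up to `K` and `1∕g_i² ≥ 1∕g₀² − i·B` for every `i ≤ K` (each
step subtracts at most `B` from `1∕g²`, which therefore never drops below `1∕γ²`; no floor on β is needed: a very negative β only makes the couplings smaller).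
[cite: Balaban1987RG1, (0.18)–(0.20) pp.255–256, §1 p.264 («uniformly bounded»)] -/
theorem window_genSeq_of_betaLe {γ B g0 : ℝ} {K : ℕ} (hγ : 0 < γ) (hB0 : 0 ≤ B) (hg0 : 0 < g0)
    (hB : ∀ k, k < K → Step.InInterval γ k (genSeq β g0) → β k (prefixOf (genSeq β g0) k) ≤ B)
    (hsmall : 1 / γ ^ 2 + B * K ≤ 1 / g0 ^ 2) :
    Step.InInterval γ K (genSeq β g0) ∧ ∀ i, i ≤ K → 1 / g0 ^ 2 - B * i ≤ 1 / genSeq β g0 i ^ 2 := by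
  suffices H : ∀ k, k ≤ K → ∀ i, i ≤ k → 0 < genSeq β g0 i ∧ 1 / g0 ^ 2 - B * i ≤ 1 / genSeq β g0 i ^ 2 from
    ⟨fun i hi => ⟨(H K le_rfl i hi).1, le_of_inv_sq_lower hγ hB0 hsmall hi (H K le_rfl i hi).1 (H K le_rfl i hi).2⟩,
      fun i hi => (H K le_rfl i hi).2⟩
  intro k
  induction k with
  | zero =>
    intro _ i hi
    obtain rfl : i = 0 := Nat.le_zero.mp hi
    rw [genSeq_zero]
    exact ⟨hg0, by simp⟩
  | succ k ih =>
    intro hk i hi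
    have hkK : k < K := Nat.lt_of_succ_le hk
    have IH := ih hkK.le
    rcases Nat.lt_or_ge i (k + 1) with hlt | hge
    · exact IH i (Nat.lt_succ_iff.mp hlt)
    · obtain rfl : i = k + 1 := le_antisymm hi hge
      -- the history up to `k` lies in the window, so the ceiling applies at step `k`
      have hW : Step.InInterval γ k (genSeq β g0) := fun j hj =>
        ⟨(IH j hj).1, le_of_inv_sq_lower hγ hB0 hsmall (hj.trans hkK.le) (IH j hj).1 (IH j hj).2⟩
      have hβ : β k (prefixOf (genSeq β g0) k) ≤ B := hB k hkK hW
      obtain ⟨hgk, hlow⟩ := IH k le_rfl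
      have hk1K : ((k + 1 : ℕ) : ℝ) ≤ K := by exact_mod_cast hk
      have hBk1 : B * ((k + 1 : ℕ) : ℝ) ≤ B * K := mul_le_mul_of_nonneg_left hk1K hB0
      have hBk : B * ((k + 1 : ℕ) : ℝ) = B * k + B := by push_cast; ring
      have hγ2 : 0 < 1 / γ ^ 2 := by positivity
      have hypos : 0 < 1 / genSeq β g0 k ^ 2 - β k (prefixOf (genSeq β g0) k) := by linarith
      rw [genSeq_succ]
      refine ⟨solveCoupling_pos hypos, ?_⟩
      rw [inv_sq_solveCoupling hypos]
      linarith

/-- **THE RUN-WISE CEILING LETTER GIVES THE ALONG-THIS-RUN CEILING**: if `β_n(g_0,…,g_n) ≤ B` at the running end of EVERY in-window (`]0, γ₀]`) solution of (0.20) (the shape delivered by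
K2⁷'s `RunConstRemainder`, §4, and by a box bound `FlowStep.BetaUpperH B γ₀ β`), then along a generated history lying in `]0, γ]`, `γ ≤ γ₀`, up to `K`: `β_j(g_0,…,g_j) ≤ B` for `j < K`.
[cite: Balaban1987RG1, (0.20) p.256, §1 p.264] -/
theorem betaLe_along_of_window {γ γ₀ B g0 : ℝ} {K : ℕ} (hγ₀ : γ ≤ γ₀)
    (hB : ∀ (n : ℕ) (gs : ℕ → ℝ), RGEqH n β gs → Step.InInterval γ₀ n gs → β n (prefixOf gs n) ≤ B)
    (hW : Step.InInterval γ K (genSeq β g0)) : ∀ j, j < K → β j (prefixOf (genSeq β g0) j) ≤ B := fun j hj =>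
  have hWj : Step.InInterval γ₀ j (genSeq β g0) := fun i hi =>
    ⟨(hW i (hi.trans hj.le)).1, (hW i (hi.trans hj.le)).2.trans hγ₀⟩
  hB j _ (rgEqH_genSeq_of_window hWj) hWj

/-- **THE UPPER RUNNING ALONG AN IN-WINDOW GENERATED HISTORY WITH A CEILING**: `0 < g_k ≤ γ` (`k ≤ K`) and `β_j(g_0,…,g_j) ≤ B` (`j < K`) give `1∕g_i² ≤ 1∕g_K² + B·(K − i)`
for `i ≤ K`. [cite: Balaban1987RG1, (0.20) p.256, (0.31) p.259] -/
theorem inv_sq_genSeq_le_top_add_of_betaLe {γ B g0 : ℝ} {K : ℕ} (hW : Step.InInterval γ K (genSeq β g0))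
    (hB : ∀ j, j < K → β j (prefixOf (genSeq β g0) j) ≤ B) {i : ℕ} (hi : i ≤ K) :
    1 / genSeq β g0 i ^ 2 ≤ 1 / genSeq β g0 K ^ 2 + B * ((K - i : ℕ) : ℝ) :=
  inv_sq_le_top_add_of_betaLe (rgEqH_genSeq_of_window hW) hB hi

end GenSeq

/-! ## §2  At the record, generic θ with `M = L^a`, `r = 1`: the guard from the window, a β-ceiling along the run and ONE floor on the last coupling — and the converse -/

section Record

variable {F : T4Family} {N : ℕ} [NeZero N]

/-- `1 < L` as a real number (the family's `L > 11`). [cite: Balaban1987RG1, (0.1) p.251 (bookkeeping)] -/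
private theorem one_lt_L_real (F : T4Family) : (1 : ℝ) < F.L := by
  have := F.hL11
  exact_mod_cast (by omega : 1 < F.L)

/-- **★★ THE RUN GUARD FROM THE WINDOW, A β-CEILING ALONG THE RUN AND ONE FLOOR ON THE LAST COUPLING** (generic θ, `θ.τ9.M = F.L^a`, `θ.ν.r = 1`): if the record's run `p` lies in
`]0, γ]` up to `K`, the record's β-functions read along it are `≤ B` (`0 ≤ B`), `a ≤ F.m`, and `log(1∕g_K² + B) ≤ L^{m−a}` for the LAST coupling `g_K`, then `PartCompat₁₃ θ p n` for
every `n ≤ K`.  (= p611474 `partCompat₁₃_of_upperRunning` with its (0.31)-hypothesis DERIVED from (0.20), `g := g_K`, `β′ := B ∕ log L`.)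
[cite: Balaban1987RG1, (0.20) p.256, (0.31) p.259, (0.1) p.251; Balaban1988Convergent, (2.1) p.254, (2.5) p.255, p.257] -/
theorem partCompat₁₃_of_window_of_betaLe_of_floor (θ : Stage13Params F N) {a : ℕ} (hM : θ.τ9.M = F.L ^ a) (hr : θ.ν.r = 1)
    (p : B12.RunParams) (ha : a ≤ F.m) {γ B : ℝ} (hB0 : 0 ≤ B)
    (hW : Step.InInterval γ p.K (gOfRecord₁₃ F N θ p))
    (hB : ∀ j, j < p.K → betaOfRecord₁₃ F N θ j (prefixOf (gOfRecord₁₃ F N θ p) j) ≤ B)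
    (hfloor : Real.log (1 / gOfRecord₁₃ F N θ p p.K ^ 2 + B) ≤ ((F.L ^ (F.m - a) : ℕ) : ℝ))
    {n : ℕ} (hn : n ≤ p.K) : PartCompat₁₃ F N θ p n := by
  have hlogL : 0 < Real.log F.L := Real.log_pos (one_lt_L_real F)
  have hL0 : Real.log F.L ≠ 0 := hlogL.ne'
  have hgK : 0 < gOfRecord₁₃ F N θ p p.K := (hW p.K le_rfl).1
  refine partCompat₁₃_of_upperRunning θ hM hr p ha (g := gOfRecord₁₃ F N θ p p.K) (β' := B / Real.log F.L) hgK
    (div_nonneg hB0 hlogL.le) (fun i hi => ⟨(hW i hi).1, ?_⟩) ?_ hn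
  · have h := inv_sq_genSeq_le_top_add_of_betaLe hW hB hi
    have heq : B / Real.log F.L * ((p.K - i : ℕ) : ℝ) * Real.log F.L = B * ((p.K - i : ℕ) : ℝ) := by
      field_simp
    rw [heq]
    exact h
  · have heq : B / Real.log F.L * Real.log F.L = B := by field_simp
    rw [heq]
    exact hfloor

/-- **★★ THE SAME FROM THE RUN-WISE CEILING LETTER** (the shape K2⁷ delivers, §4; or print's box bound p. 264): `β_n(g_0,…,g_n) ≤ B` at the running end of every in-window
(`]0, γ₀]`) solution of (0.20), the run in `]0, γ]` (`γ ≤ γ₀`) up to `K`, `a ≤ F.m`, and the floor `log(1∕g_K² + B) ≤ L^{m−a}` ⇒ `PartCompat₁₃ θ p n`, `n ≤ K`.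
[cite: Balaban1987RG1, (0.20) p.256, (0.31) p.259, §1 p.264; Balaban1988Convergent, (2.1) p.254, (2.5) p.255, p.257] -/
theorem partCompat₁₃_of_window_of_betaLeAlongRuns_of_floor (θ : Stage13Params F N) {a : ℕ} (hM : θ.τ9.M = F.L ^ a) (hr : θ.ν.r = 1)
    (p : B12.RunParams) (ha : a ≤ F.m) {γ γ₀ B : ℝ} (hγ₀ : γ ≤ γ₀) (hB0 : 0 ≤ B)
    (hB : ∀ (n : ℕ) (gs : ℕ → ℝ), RGEqH n (betaOfRecord₁₃ F N θ) gs → Step.InInterval γ₀ n gs → betaOfRecord₁₃ F N θ n (prefixOf gs n) ≤ B)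
    (hW : Step.InInterval γ p.K (gOfRecord₁₃ F N θ p))
    (hfloor : Real.log (1 / gOfRecord₁₃ F N θ p p.K ^ 2 + B) ≤ ((F.L ^ (F.m - a) : ℕ) : ℝ))
    {n : ℕ} (hn : n ≤ p.K) : PartCompat₁₃ F N θ p n :=
  partCompat₁₃_of_window_of_betaLe_of_floor θ hM hr p ha hB0 hW (betaLe_along_of_window hγ₀ hB hW) hfloor hn

/-- **★ THE CONVERSE — A COMPATIBLE FULL-LENGTH RUN HAS ITS LAST COUPLING ABOVE THE FLOOR**: at `θ.τ9.M = F.L^a`, `θ.ν.r = 1`, `K ≥ 1`: `PartCompat₁₃ θ p K` ⇒ `a ≤ F.m` and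
`log g_K⁻² ≤ L^{m−a}` (p608879 `log_pow_le_of_partCompat₁₃` at the last level).  With §2 ★★: on in-window (0.20)-runs with `0 ≤ β ≤`-ceiling `B`, the guard at full length sits
between the two floors `log g_K⁻² ≤ L^{m−a}` (necessary) and `log(g_K⁻² + B) ≤ L^{m−a}` (sufficient) — A FLOOR ON THE RENORMALISED COUPLING.
[cite: Balaban1988Convergent, (2.1) p.254, (2.5) p.255, p.257; Balaban1987RG1, (0.1) p.251, Thm 2 p.259 (`g_K = g`)] -/
theorem floor_of_partCompat₁₃_top (θ : Stage13Params F N) {a : ℕ} (hM : θ.τ9.M = F.L ^ a) (hr : θ.ν.r = 1)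
    (p : B12.RunParams) (hK : 1 ≤ p.K) (h : PartCompat₁₃ F N θ p p.K) :
    a ≤ F.m ∧ Real.log (gOfRecord₁₃ F N θ p p.K ^ 2)⁻¹ ≤ ((F.L ^ (F.m - a) : ℕ) : ℝ) := by
  obtain ⟨hroom, hlog⟩ := log_pow_le_of_partCompat₁₃ θ hM p h hK le_rfl
  rw [hr, pow_one, show F.m + p.K - p.K - a = F.m - a by omega] at hlog
  exact ⟨by omega, hlog⟩

/-- **★★ β-FREE: BELOW THE THRESHOLD WINDOW NO RUN OF POSITIVE LENGTH IS PARTITION-COMPATIBLE** (generic θ, `M = L^a`, `r = 1`): if the run lies in `]0, γ]` up to `K ≥ 1` with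
`γ < exp(−L^{m−a}∕2)`, then `g_K ≤ γ` puts `log g_K⁻² > L^{m−a}` — against the floor forced by `PartCompat₁₃ θ p K` (§2 ★).  No β-letter at all.
[cite: Balaban1988Convergent, (2.1) p.254, (2.5) p.255, p.257; Balaban1987RG1, (0.1) p.251, Thm 1 p.259 (the window)] -/
theorem not_partCompat₁₃_top_of_window_lt_threshold (θ : Stage13Params F N) {a : ℕ} (hM : θ.τ9.M = F.L ^ a) (hr : θ.ν.r = 1)
    (p : B12.RunParams) (hK : 1 ≤ p.K) {γ : ℝ} (hW : Step.InInterval γ p.K (gOfRecord₁₃ F N θ p))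
    (hγ : γ < Real.exp (-((F.L ^ (F.m - a) : ℕ) : ℝ) / 2)) : ¬ PartCompat₁₃ F N θ p p.K := by
  intro h
  obtain ⟨-, hlog⟩ := floor_of_partCompat₁₃_top θ hM hr p hK h
  set T : ℝ := ((F.L ^ (F.m - a) : ℕ) : ℝ) with hT
  obtain ⟨hg, hgγ⟩ := hW p.K le_rfl
  have hglt : gOfRecord₁₃ F N θ p p.K < Real.exp (-T / 2) := lt_of_le_of_lt hgγ hγ
  have hsq : gOfRecord₁₃ F N θ p p.K ^ 2 < Real.exp (-T) := by
    have h1 : gOfRecord₁₃ F N θ p p.K ^ 2 < Real.exp (-T / 2) ^ 2 := by gcongr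
    have h2 : Real.exp (-T / 2) ^ 2 = Real.exp (-T) := by
      rw [sq, ← Real.exp_add]
      congr 1
      ring
    rwa [h2] at h1
  have hpos : 0 < gOfRecord₁₃ F N θ p p.K ^ 2 := by positivity
  have hinv : Real.exp T < (gOfRecord₁₃ F N θ p p.K ^ 2)⁻¹ := by
    have h1 := one_div_lt_one_div_of_lt hpos hsq
    rwa [one_div, one_div, Real.exp_neg, inv_inv] at h1
  have hlogT : T < Real.log (gOfRecord₁₃ F N θ p p.K ^ 2)⁻¹ := by
    have h1 := Real.log_lt_log (Real.exp_pos T) hinv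
    rwa [Real.log_exp] at h1
  linarith

/-- **★★★ β-FREE: THE WINDOW CLAUSE OF K1⁷'s OWN CONSEQUENT REFUTES THE ∀-WINDOW GUARD BINDER BELOW THE THRESHOLD** (generic θ, `M = L^a`, `r = 1`; LOCATED, count-neutral): if SOME
run of positive length lies in `]0, γ]` (the shape `∃ P, 1 ≤ P.K ∧ window γ P` of the crux's last conjunct, read at the datum's couplings) and `γ < exp(−L^{m−a}∕2)`, then
`∀ P, Step.InInterval γ P.K (gOfRecord₁₃ θ P) → PartCompat₁₃ θ P P.K` is FALSE.  (§3 ★★★ below removes the threshold under a β-ceiling.)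
[cite: Balaban1988Convergent, p.257; Balaban1987RG1, Thm 1 p.259; Balaban1989LargeFieldII, Thm 1 p.355 (the one-sided window)] -/
theorem not_forall_window_partCompat₁₃_of_exists_run_of_lt_threshold (θ : Stage13Params F N) {a : ℕ} (hM : θ.τ9.M = F.L ^ a) (hr : θ.ν.r = 1)
    {γ : ℝ} (hγ : γ < Real.exp (-((F.L ^ (F.m - a) : ℕ) : ℝ) / 2))
    (hex : ∃ P : B12.RunParams, 1 ≤ P.K ∧ Step.InInterval γ P.K (gOfRecord₁₃ F N θ P)) :
    ¬ ∀ P : B12.RunParams, Step.InInterval γ P.K (gOfRecord₁₃ F N θ P) → PartCompat₁₃ F N θ P P.K := fun hPC => by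
  obtain ⟨P, hK, hW⟩ := hex
  exact not_partCompat₁₃_top_of_window_lt_threshold θ hM hr P hK hW hγ (hPC P hW)

end Record

/-! ## §3  LOCATED: the ∀-window guard binder is unsatisfiable — tiny bare couplings stay in the window and leave the last cube bigger than the torus -/

section Located

variable {F : T4Family} {N : ℕ} [NeZero N]

/-- **★★★ FOR EVERY WINDOW AND EVERY LENGTH THERE IS AN IN-WINDOW RUN THAT IS NOT PARTITION-COMPATIBLE** (generic θ with `θ.τ9.M = F.L^a`, `1 ≤ θ.ν.r`): if the record's β read
along in-window (`]0, γ₀]`) solutions of (0.20) is `≤ B` at the running end, then for every `γ ∈ ]0, γ₀]`, every `K ≥ 1` and every `m` some bare coupling `g₀` (namely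
`1∕g₀² = 1∕γ² + max(B,0)·K + e^{T+1}`, `T = L^{m+K−K−a}`) generates a run of the record in `]0, γ]` up to `K` with `log g_K⁻² ≥ T + 1`, hence NOT `PartCompat₁₃` at `K`.
[cite: Balaban1987RG1, (0.18)–(0.20) pp.255–256, §1 p.264; Balaban1988Convergent, (2.1) p.254, (2.5) p.255, p.257] -/
theorem exists_window_not_partCompat₁₃_of_betaLe (θ : Stage13Params F N) {a : ℕ} (hM : θ.τ9.M = F.L ^ a) (hr : 1 ≤ θ.ν.r)
    {γ₀ B : ℝ}
    (hB : ∀ (n : ℕ) (gs : ℕ → ℝ), RGEqH n (betaOfRecord₁₃ F N θ) gs → Step.InInterval γ₀ n gs → betaOfRecord₁₃ F N θ n (prefixOf gs n) ≤ B)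
    {γ : ℝ} (hγ : 0 < γ) (hγ₀ : γ ≤ γ₀) {K : ℕ} (hK : 1 ≤ K) (m : ℕ) :
    ∃ g0 : ℝ, Step.InInterval γ K (gOfRecord₁₃ F N θ ⟨K, m, g0⟩) ∧ ¬ PartCompat₁₃ F N θ ⟨K, m, g0⟩ K := by
  set β := betaOfRecord₁₃ F N θ with hβdef
  set B' : ℝ := max B 0 with hB'def
  have hB'0 : 0 ≤ B' := le_max_right _ _
  set T : ℝ := ((F.L ^ (F.m + K - K - a) : ℕ) : ℝ) with hTdef
  have hT0 : 0 ≤ T := by positivity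
  set y : ℝ := 1 / γ ^ 2 + B' * K + Real.exp (T + 1) with hydef
  have hγ2 : 0 < 1 / γ ^ 2 := by positivity
  have hexp : 0 < Real.exp (T + 1) := Real.exp_pos _
  have hy : 0 < y := by positivity
  set g0 : ℝ := solveCoupling y with hg0def
  have hg0 : 0 < g0 := solveCoupling_pos hy
  have hg0y : 1 / g0 ^ 2 = y := inv_sq_solveCoupling hy
  -- the along-this-run ceiling with `B' ≥ B`, whenever the history has stayed in the window so far
  have hBrun : ∀ k, k < K → Step.InInterval γ k (genSeq β g0) → β k (prefixOf (genSeq β g0) k) ≤ B' := by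
    intro k _ hWk
    have hWk₀ : Step.InInterval γ₀ k (genSeq β g0) := fun i hi => ⟨(hWk i hi).1, (hWk i hi).2.trans hγ₀⟩
    exact (hB k _ (rgEqH_genSeq_of_window hWk₀) hWk₀).trans (le_max_left _ _)
  have hsmall : 1 / γ ^ 2 + B' * K ≤ 1 / g0 ^ 2 := by rw [hg0y]; linarith [hexp.le]
  obtain ⟨hW, hlow⟩ := window_genSeq_of_betaLe hγ hB'0 hg0 hBrun hsmall
  refine ⟨g0, hW, fun hPC => ?_⟩
  -- the last coupling is below `e^{−(T+1)∕2}`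
  have hKlow := hlow K le_rfl
  have hinv : Real.exp (T + 1) ≤ (genSeq β g0 K ^ 2)⁻¹ := by
    rw [← one_div]
    linarith
  have hlogK : T + 1 ≤ Real.log (genSeq β g0 K ^ 2)⁻¹ := by
    have h := Real.log_le_log hexp hinv
    rwa [Real.log_exp] at h
  -- but compatibility at `K` caps `(log g_K⁻²)^r` by `T`
  have hcap : (Real.log (genSeq β g0 K ^ 2)⁻¹) ^ θ.ν.r ≤ T :=
    (log_pow_le_of_partCompat₁₃ θ hM ⟨K, m, g0⟩ hPC hK le_rfl).2
  have hone : 1 ≤ Real.log (genSeq β g0 K ^ 2)⁻¹ := by linarith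
  have hself : Real.log (genSeq β g0 K ^ 2)⁻¹ ≤ (Real.log (genSeq β g0 K ^ 2)⁻¹) ^ θ.ν.r :=
    le_self_pow₀ hone (by omega)
  linarith

/-- **★★★ THE ∀-WINDOW GUARD BINDER IS UNSATISFIABLE AT EVERY `γ > 0`** (LOCATED, count-neutral): under the run-wise β-ceiling at SOME level `γ₀ > 0`, for EVERY `γ > 0` the
displayed binder family `∀ P, Step.InInterval γ P.K (gOfRecord₁₃ θ P) → PartCompat₁₃ θ P P.K` (dag-n11-w1 g2 p607924 ∕ p609410 ∕ p611894 ∕ p613848's `hPC`) is FALSE — at every `θ`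
with `M = L^a`, `1 ≤ r` (a window `]0, γ]` contains the window `]0, min γ γ₀]`, where §3 ★★★ supplies an incompatible run of length `1`).  Nothing registered is denied; it says the
guard cannot be asked for all runs of a one-sided window. [cite: Balaban1987RG1, (0.20) p.256, §1 p.264; Balaban1988Convergent, p.257] -/
theorem not_forall_window_partCompat₁₃_of_betaLe (θ : Stage13Params F N) {a : ℕ} (hM : θ.τ9.M = F.L ^ a) (hr : 1 ≤ θ.ν.r)
    {γ₀ B : ℝ} (hγ₀ : 0 < γ₀)
    (hB : ∀ (n : ℕ) (gs : ℕ → ℝ), RGEqH n (betaOfRecord₁₃ F N θ) gs → Step.InInterval γ₀ n gs → betaOfRecord₁₃ F N θ n (prefixOf gs n) ≤ B)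
    {γ : ℝ} (hγ : 0 < γ) :
    ¬ ∀ P : B12.RunParams, Step.InInterval γ P.K (gOfRecord₁₃ F N θ P) → PartCompat₁₃ F N θ P P.K := by
  intro hPC
  obtain ⟨g0, hW, hnot⟩ :=
    exists_window_not_partCompat₁₃_of_betaLe θ hM hr hB (lt_min hγ hγ₀) (min_le_right γ γ₀) le_rfl 0
  exact hnot (hPC ⟨1, 0, g0⟩ fun i hi => ⟨(hW i hi).1, (hW i hi).2.trans (min_le_left γ γ₀)⟩)

end Located

/-! ## §4  In K2⁷'s currency: the SHAPE of `RunConstRemainder β b r γ₀` (unfolded; no K2 import) -/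

section RunLetter

variable {F : T4Family} {N : ℕ} [NeZero N]

/-- **K2⁷'s RUN LETTER GIVES THE RUN-WISE CEILING**: `|β_k(g_0,…,g_k) − b_k| ≤ r` for `k ≤ n` along every in-window (`]0, γ₀]`) solution of (0.20) up to `n` (= the body of
`BalabanUVNodesK2NamedJetsRunRemAt.RunConstRemainder β b r γ₀`) and `b_k ≤ B` ⇒ `β_n(g_0,…,g_n) ≤ B + r` at the running end. [cite: Balaban1987RG1, (1.20)–(1.22) p.264, §1 p.264] -/
theorem betaLe_of_runConstRemainder {β : HBeta} {b : ℕ → ℝ} {r γ₀ B : ℝ}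
    (hrem : ∀ (n : ℕ) (gs : ℕ → ℝ), RGEqH n β gs → Step.InInterval γ₀ n gs → ∀ k, k ≤ n → |β k (prefixOf gs k) - b k| ≤ r)
    (hb : ∀ k, b k ≤ B) :
    ∀ (n : ℕ) (gs : ℕ → ℝ), RGEqH n β gs → Step.InInterval γ₀ n gs → β n (prefixOf gs n) ≤ B + r := by
  intro n gs hrg hI
  have h := (abs_le.mp (hrem n gs hrg hI n le_rfl)).2
  linarith [hb n]

/-- **★★ THE RUN GUARD FROM THE WINDOW, K2⁷'s RUN LETTER AND ONE FLOOR ON THE LAST COUPLING** (generic θ, `M = L^a`, `r = 1`): the record's β within `r` of a profile `b ≤ B` along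
in-window (0.20)-runs at level `γ₀`, the run in `]0, γ]` (`γ ≤ γ₀`) up to `K`, `a ≤ F.m`, and `log(1∕g_K² + max(B + r, 0)) ≤ L^{m−a}` ⇒ `PartCompat₁₃ θ p n` for every `n ≤ K`.
[cite: Balaban1987RG1, (0.20) p.256, (0.31) p.259, (1.20)–(1.22) p.264; Balaban1988Convergent, (2.1) p.254, (2.5) p.255, p.257] -/
theorem partCompat₁₃_of_window_of_runConstRemainder_of_floor (θ : Stage13Params F N) {a : ℕ} (hM : θ.τ9.M = F.L ^ a) (hr : θ.ν.r = 1)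
    (p : B12.RunParams) (ha : a ≤ F.m) {γ γ₀ r B : ℝ} {b : ℕ → ℝ} (hγ₀ : γ ≤ γ₀)
    (hrem : ∀ (n : ℕ) (gs : ℕ → ℝ), RGEqH n (betaOfRecord₁₃ F N θ) gs → Step.InInterval γ₀ n gs →
      ∀ k, k ≤ n → |betaOfRecord₁₃ F N θ k (prefixOf gs k) - b k| ≤ r)
    (hb : ∀ k, b k ≤ B)
    (hW : Step.InInterval γ p.K (gOfRecord₁₃ F N θ p))
    (hfloor : Real.log (1 / gOfRecord₁₃ F N θ p p.K ^ 2 + max (B + r) 0) ≤ ((F.L ^ (F.m - a) : ℕ) : ℝ))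
    {n : ℕ} (hn : n ≤ p.K) : PartCompat₁₃ F N θ p n :=
  partCompat₁₃_of_window_of_betaLeAlongRuns_of_floor θ hM hr p ha hγ₀ (le_max_right _ _)
    (fun n gs hrg hI => (betaLe_of_runConstRemainder hrem hb n gs hrg hI).trans (le_max_left _ _)) hW hfloor hn

/-- **★★★ UNDER K2⁷'s RUN LETTER (level `γ₀ > 0`) THE ∀-WINDOW GUARD BINDER IS FALSE AT EVERY `γ > 0`** (generic θ, `M = L^a`, `1 ≤ r`; LOCATED, count-neutral).
[cite: Balaban1987RG1, (0.20) p.256, (1.20)–(1.22) p.264, §1 p.264; Balaban1988Convergent, p.257] -/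
theorem not_forall_window_partCompat₁₃_of_runConstRemainder (θ : Stage13Params F N) {a : ℕ} (hM : θ.τ9.M = F.L ^ a) (hr : 1 ≤ θ.ν.r)
    {γ₀ r B : ℝ} {b : ℕ → ℝ} (hγ₀ : 0 < γ₀)
    (hrem : ∀ (n : ℕ) (gs : ℕ → ℝ), RGEqH n (betaOfRecord₁₃ F N θ) gs → Step.InInterval γ₀ n gs →
      ∀ k, k ≤ n → |betaOfRecord₁₃ F N θ k (prefixOf gs k) - b k| ≤ r)
    (hb : ∀ k, b k ≤ B) {γ : ℝ} (hγ : 0 < γ) :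
    ¬ ∀ P : B12.RunParams, Step.InInterval γ P.K (gOfRecord₁₃ F N θ P) → PartCompat₁₃ F N θ P P.K :=
  not_forall_window_partCompat₁₃_of_betaLe θ hM hr hγ₀ (betaLe_of_runConstRemainder hrem hb) hγ

end RunLetter

/-! ## §5  At K1's witness of record `θ₁₅ᶜᶜᴹᵂ(j; γ)` (`M = L^j`, `r = 1`) -/

section Witness

variable (F : T4Family) (N : ℕ) [NeZero N] (j : ℕ) (γ ε₀ ε₂₉ B₃ B₃' a₀ a₁ : ℝ)

/-- **★★ THE RUN GUARD AT θ₁₅ᶜᶜᴹᵂ(j; γ) FROM THE WINDOW, A β-CEILING ALONG THE RUN AND THE FLOOR `log(1∕g_K² + B) ≤ L^{m−j}`** (`j ≤ F.m`; `M = L^j`, `r = 1` are dag-n21-c's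
`rfl` letters). [cite: Balaban1987RG1, (0.20) p.256, (0.31) p.259; Balaban1988Convergent, (2.1) p.254, (2.5) p.255, p.257; Balaban1989LargeFieldI, (2.1) p.182] -/
theorem partCompat₁₃_theta13OfThm1CCMW_of_window_of_betaLe_of_floor (p : B12.RunParams) (hj : j ≤ F.m) {γ' B : ℝ} (hB0 : 0 ≤ B)
    (hW : Step.InInterval γ' p.K (gOfRecord₁₃ F N (theta13OfThm1CCMW F N j γ ε₀ ε₂₉ B₃ B₃' a₀ a₁) p))
    (hB : ∀ i, i < p.K → betaOfRecord₁₃ F N (theta13OfThm1CCMW F N j γ ε₀ ε₂₉ B₃ B₃' a₀ a₁) i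
      (prefixOf (gOfRecord₁₃ F N (theta13OfThm1CCMW F N j γ ε₀ ε₂₉ B₃ B₃' a₀ a₁) p) i) ≤ B)
    (hfloor : Real.log (1 / gOfRecord₁₃ F N (theta13OfThm1CCMW F N j γ ε₀ ε₂₉ B₃ B₃' a₀ a₁) p p.K ^ 2 + B) ≤ ((F.L ^ (F.m - j) : ℕ) : ℝ))
    {n : ℕ} (hn : n ≤ p.K) : PartCompat₁₃ F N (theta13OfThm1CCMW F N j γ ε₀ ε₂₉ B₃ B₃' a₀ a₁) p n :=
  partCompat₁₃_of_window_of_betaLe_of_floor (theta13OfThm1CCMW F N j γ ε₀ ε₂₉ B₃ B₃' a₀ a₁)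
    (theta13OfThm1CCMW_τ9_M F N j γ ε₀ ε₂₉ B₃ B₃' a₀ a₁) (theta13OfThm1CCMW_r F N j γ ε₀ ε₂₉ B₃ B₃' a₀ a₁) p hj hB0 hW hB hfloor hn

/-- **★★★ AT θ₁₅ᶜᶜᴹᵂ(j; γ) THE ∀-WINDOW GUARD BINDER IS FALSE AT EVERY `γ′ > 0`** under the run-wise β-ceiling at some level `γ₀ > 0` (LOCATED, count-neutral; `r = 1`).
[cite: Balaban1987RG1, (0.20) p.256, §1 p.264; Balaban1988Convergent, p.257; Balaban1989LargeFieldI, (2.1) p.182] -/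
theorem not_forall_window_partCompat₁₃_theta13OfThm1CCMW_of_betaLe {γ₀ B : ℝ} (hγ₀ : 0 < γ₀)
    (hB : ∀ (n : ℕ) (gs : ℕ → ℝ), RGEqH n (betaOfRecord₁₃ F N (theta13OfThm1CCMW F N j γ ε₀ ε₂₉ B₃ B₃' a₀ a₁)) gs → Step.InInterval γ₀ n gs →
      betaOfRecord₁₃ F N (theta13OfThm1CCMW F N j γ ε₀ ε₂₉ B₃ B₃' a₀ a₁) n (prefixOf gs n) ≤ B)
    {γ' : ℝ} (hγ' : 0 < γ') :
    ¬ ∀ P : B12.RunParams, Step.InInterval γ' P.K (gOfRecord₁₃ F N (theta13OfThm1CCMW F N j γ ε₀ ε₂₉ B₃ B₃' a₀ a₁) P) →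
      PartCompat₁₃ F N (theta13OfThm1CCMW F N j γ ε₀ ε₂₉ B₃ B₃' a₀ a₁) P P.K :=
  not_forall_window_partCompat₁₃_of_betaLe (theta13OfThm1CCMW F N j γ ε₀ ε₂₉ B₃ B₃' a₀ a₁)
    (theta13OfThm1CCMW_τ9_M F N j γ ε₀ ε₂₉ B₃ B₃' a₀ a₁) (by rw [theta13OfThm1CCMW_r]) hγ₀ hB hγ'

end Witness

end Summit.QuantumFields.YangMills.Theorems.BalabanUVNodesN11RunGuardIsCouplingFloor

end
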